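import Literature.NumberTheory.Transcendental.NesterenkoMultiplicityForms
import Literature.NumberTheory.Transcendental.NesterenkoMultiplicityProofs
import Mathlib.Algebra.BigOperators.NatAntidiagonal
import Mathlib.Data.Nat.Factorial.Basic
import Mathlib.RingTheory.Ideal.Operations
import Literature.RingTheory.MvPolynomial.HomogeneousHilbertFunction
import HarnessLib

/-!
# Nesterenko's multiplicity estimate (LNM 1752 Ch. 10): the differential algebra of Prop. 3.6 on the affine side — proofs only

`Literature/NumberTheory/Transcendental/NesterenkoMultiplicityAffine.lean` — proofs only (no
definitions, no named facts, nothing asserted). Part of the discharge of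
`NesterenkoMultiplicity.NesterenkoPhilippon2001_ch10_thm_1_1` along the printed proof of Prop. 3.6
(Ch. 10, pp. 157–160). The homogenised operator `T = B₀ ∂/∂z + Σ B_j x₀ ∂/∂x_j` of p. 155 is the
operator `D` of (40) read through the homogenisation `A ↦ x₀ⁿ A(x/x₀)` (`homogTo`,
`NesterenkoMultiplicityForms.lean`); accordingly the `T`-iterates `Tʲ E` and the ideals they generate
are handled here on `ℂ[z, x₁, …, x_m]` with the derivation `D = dDer A`, and only the ideals of
`K[x̲]` spanned by homogenisations (`𝔞_n`, `J_n` of p. 158) are pushed to `K[x̲]`. Proved: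

* iterated derivations (any commutative ring; cf. the tree's `NesterenkoCh10.*` in
  `Literature/Barriers/Schanuel`, restated to keep this topic self-contained): Leibniz for iterates
  `iterate_apply_mul_eq_sum`, `iterate_apply_mem_of_span_of_forall` (iterates of an ideal from iterates of
  its generators), `iterate_apply_pow_mem_span_of_lt`, `iterate_apply_pow_self_sub_mem_span`,
  **`apply_mem_of_forall_pow_mul_mem'`** (the step of p. 159: `Tˡ(𝔞) ⊂ 𝔮`, `𝔮ˡH ⊂ 𝔞`, `H ∉ 𝔮` ⇒
  `T𝔮 ⊂ 𝔮`), `natCast_factorial_notMem'`, and the peeling lemma `iterate_apply_mem_of_mul`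
  (`Dʲ(c a) ∈ 𝔮` for `j ≤ l`, `c ∉ 𝔮` ⇒ `Dʲ a ∈ 𝔮` for `j ≤ l`);
* spans of iterates: `iterate_mem_span_iterate` (`a ∈ (DᵏE : k < c) ⇒ Dʲa ∈ (DᵏE : k < c + j)`,
  p. 159: "Condition 2 follows from definition of `E_{n+1}` and (63)");
* degrees under `D`: `xDegree_pderiv_le`, `degreeOf_zero_pderiv_le`, `xDegree_dOp_le`,
  `degreeOf_zero_dOp_le` and their iterates (p. 159: "`deg E_{n+1} ≤ b_n(L+1) + 2d₀λa_n`");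
* the passage `K[x̲] ⟶ ℂ[z, x̲]`: `exists_aeval_mul_mem_span_of_mem_affContr` (if
  `x₀ⁿ a(x/x₀) ∈ (Ê₀, …, Ê_k) K[x̲]` then `c(z) a ∈ (E₀, …, E_k) ℂ[z, x̲]` for some `c ≠ 0`),
  `aeval_X_zero_notMem_affContr` (`c(z) ∉ 𝔞(𝔮)` for `x₀ ∉ 𝔮`), `mem_affContr_of_mem_span`.

## References

* [NesterenkoPhilippon2001] Yu. V. Nesterenko, P. Philippon (eds.), *Introduction to Algebraic
  Independence Theory*, LNM 1752, Springer 2001, Ch. 10 §3, proof of Prop. 3.6 (pp. 157–160),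
  Lemma 3.4 (p. 155).
-/

noncomputable section

open MvPolynomial Finset
open scoped Polynomial

namespace Literature.NumberTheory.Transcendental

namespace NesterenkoMultiplicity

/-! ### Iterated derivations (any commutative ring) -/

section Derivations

variable {R A : Type*} [CommSemiring R] [CommRing A] [Algebra R A] (D : Derivation R A A)

/-- **Leibniz rule for iterates**: `Dⁿ(fg) = Σ_{i+j=n} (n choose i) Dⁱf Dʲg`. [folklore] -/
theorem iterate_apply_mul_eq_sum (f g : A) : ∀ n : ℕ,
    D^[n] (f * g) = ∑ p ∈ antidiagonal n, n.choose p.1 • (D^[p.1] f * D^[p.2] g) := by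
  intro n
  induction n with
  | zero => simp
  | succ n ih =>
    have h1 : ∑ q ∈ antidiagonal (n + 1), n.choose q.1 • (D^[q.1] f * D^[q.2] g) =
        ∑ p ∈ antidiagonal n, n.choose p.1 • (D^[p.1] f * D^[p.2 + 1] g) := by
      rw [Finset.Nat.sum_antidiagonal_succ']; simp
    have h2 : ∑ q ∈ antidiagonal (n + 1), n.choose q.1 • (D^[q.1] f * D^[q.2] g) =
        f * D^[n + 1] g +
          ∑ p ∈ antidiagonal n, n.choose (p.1 + 1) • (D^[p.1 + 1] f * D^[p.2] g) := by
      rw [Finset.Nat.sum_antidiagonal_succ]; simp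
    have h4 : ∀ p : ℕ × ℕ, D (n.choose p.1 • (D^[p.1] f * D^[p.2] g)) =
        n.choose p.1 • (D^[p.1 + 1] f * D^[p.2] g) + n.choose p.1 • (D^[p.1] f * D^[p.2 + 1] g) := by
      intro p
      rw [map_nsmul, Derivation.leibniz, smul_eq_mul, smul_eq_mul, Function.iterate_succ_apply',
        Function.iterate_succ_apply', ← smul_add]
      congr 1; ring
    calc D^[n + 1] (f * g)
        = D (∑ p ∈ antidiagonal n, n.choose p.1 • (D^[p.1] f * D^[p.2] g)) := by
          rw [Function.iterate_succ_apply', ih]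
      _ = ∑ p ∈ antidiagonal n, n.choose p.1 • (D^[p.1 + 1] f * D^[p.2] g) +
            ∑ p ∈ antidiagonal n, n.choose p.1 • (D^[p.1] f * D^[p.2 + 1] g) := by
          rw [map_sum]; simp_rw [h4]; rw [Finset.sum_add_distrib]
      _ = ∑ p ∈ antidiagonal n, n.choose p.1 • (D^[p.1 + 1] f * D^[p.2] g) +
            (f * D^[n + 1] g +
              ∑ p ∈ antidiagonal n, n.choose (p.1 + 1) • (D^[p.1 + 1] f * D^[p.2] g)) := by
          rw [h1.symm.trans h2]
      _ = f * D^[n + 1] g +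
            ∑ p ∈ antidiagonal n, (n.choose p.1 + n.choose (p.1 + 1)) •
              (D^[p.1 + 1] f * D^[p.2] g) := by
          simp_rw [add_smul, Finset.sum_add_distrib]; abel
      _ = ∑ q ∈ antidiagonal (n + 1), (n + 1).choose q.1 • (D^[q.1] f * D^[q.2] g) := by
          rw [Finset.Nat.sum_antidiagonal_succ]
          simp only [Nat.choose_zero_right, one_smul, Function.iterate_zero, id_eq,
            Nat.choose_succ_succ']

/-- **Iterates of an ideal from iterates of its generators**: if `Dᵏg ∈ 𝔮` for all `k ≤ l` and all
`g` in a generating set `S` of `𝔞`, then `Dᵏa ∈ 𝔮` for all `k ≤ l`, `a ∈ 𝔞` (Leibniz).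
[cite: NesterenkoPhilippon2001, Ch. 10 proof of Prop. 3.6 (p. 159)] -/
theorem iterate_apply_mem_of_span_of_forall {S : Set A} {𝔮 : Ideal A} {l : ℕ}
    (hS : ∀ g ∈ S, ∀ k ≤ l, D^[k] g ∈ 𝔮) :
    ∀ a ∈ Ideal.span S, ∀ k ≤ l, D^[k] a ∈ 𝔮 := by
  intro a ha
  refine Submodule.span_induction (p := fun a _ => ∀ k ≤ l, D^[k] a ∈ 𝔮) ?_ ?_ ?_ ?_ ha
  · exact fun g hg k hk => hS g hg k hk
  · intro k _; rw [iterate_map_zero D k]; exact 𝔮.zero_mem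
  · intro x y _ _ hx hy k hk
    rw [iterate_map_add]; exact 𝔮.add_mem (hx k hk) (hy k hk)
  · intro r x _ hx k hk
    rw [smul_eq_mul, iterate_apply_mul_eq_sum]
    refine 𝔮.sum_mem fun p hp => ?_
    rw [mem_antidiagonal] at hp
    exact Submodule.smul_of_tower_mem _ _ (𝔮.mul_mem_left _ (hx p.2 (by omega)))

/-- `D(n·y) = n·Dy` in product form. [folklore] -/
theorem apply_natCast_mul' (n : ℕ) (y : A) : D ((n : A) * y) = (n : A) * D y := by
  rw [Derivation.leibniz, Derivation.map_natCast, smul_zero, add_zero, smul_eq_mul]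

/-- `D(x^{n+1}) = (n+1) xⁿ Dx` in product form. [folklore] -/
theorem apply_pow_succ' (x : A) (n : ℕ) : D (x ^ (n + 1)) = ((n + 1 : ℕ) : A) * x ^ n * D x := by
  rw [Derivation.leibniz_pow, Nat.add_sub_cancel, smul_eq_mul, nsmul_eq_mul]; ring

/-- `G^{a+1} ∣ Dᵏ(G^{a+k}) − ((a+k)!/a!) Gᵃ (DG)ᵏ`. [folklore] -/
theorem dvd_iterate_apply_pow_sub' (G : A) (k : ℕ) : ∀ a : ℕ,
    G ^ (a + 1) ∣ D^[k] (G ^ (a + k)) - (((a + k).descFactorial k : ℕ) : A) * (G ^ a * D G ^ k) := by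
  induction k with
  | zero => intro a; simp
  | succ k ih =>
    intro a
    obtain ⟨W, hW⟩ := ih (a + 1)
    have e1 : a + 1 + k = a + (k + 1) := by ring
    rw [e1] at hW
    have hW' : D^[k] (G ^ (a + (k + 1))) =
        (((a + (k + 1)).descFactorial k : ℕ) : A) * (G ^ (a + 1) * D G ^ k) + G ^ (a + 1 + 1) * W := by
      rw [← hW]; ring
    have hdesc : (a + (k + 1)).descFactorial (k + 1) = (a + 1) * (a + (k + 1)).descFactorial k := by
      rw [Nat.descFactorial_succ]; congr 1; omega
    have hstep : D^[k + 1] (G ^ (a + (k + 1))) =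
        (((a + (k + 1)).descFactorial k : ℕ) : A) *
            ((((a + 1 : ℕ) : A) * G ^ a * D G) * D G ^ k + G ^ (a + 1) * D (D G ^ k)) +
          ((((a + 1 + 1 : ℕ) : A) * G ^ (a + 1) * D G) * W + G ^ (a + 1 + 1) * D W) := by
      rw [Function.iterate_succ_apply', hW', map_add, apply_natCast_mul', Derivation.leibniz,
        Derivation.leibniz (D := D) (G ^ (a + 1 + 1)), apply_pow_succ', apply_pow_succ']
      simp only [smul_eq_mul]; ring
    refine ⟨(((a + (k + 1)).descFactorial k : ℕ) : A) * D (D G ^ k) +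
        (((a + 1 + 1 : ℕ) : A) * D G) * W + G * D W, ?_⟩
    rw [hstep, hdesc]; push_cast; ring

/-- For `k < l`, `Dᵏ(Gˡ) ∈ (G)`. [folklore] -/
theorem iterate_apply_pow_mem_span_of_lt' (G : A) {k l : ℕ} (hkl : k < l) :
    D^[k] (G ^ l) ∈ Ideal.span {G} := by
  obtain ⟨a, rfl⟩ : ∃ a, l = (a + 1) + k := ⟨l - k - 1, by omega⟩
  obtain ⟨W, hW⟩ := dvd_iterate_apply_pow_sub' D G k (a + 1)
  have e : D^[k] (G ^ (a + 1 + k)) =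
      (((a + 1 + k).descFactorial k : ℕ) : A) * (G ^ (a + 1) * D G ^ k) + G ^ (a + 1 + 1) * W := by
    rw [← hW]; ring
  rw [e]
  exact (Ideal.span {G}).add_mem
    (Ideal.mem_span_singleton.mpr
      (Dvd.intro ((((a + 1 + k).descFactorial k : ℕ) : A) * G ^ a * D G ^ k) (by ring)))
    (Ideal.mem_span_singleton.mpr (Dvd.intro (G ^ (a + 1) * W) (by ring)))

/-- `Dˡ(Gˡ) ≡ l! (DG)ˡ (mod G)`. [folklore] -/
theorem iterate_apply_pow_self_sub_mem_span' (G : A) (l : ℕ) :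
    D^[l] (G ^ l) - ((l.factorial : ℕ) : A) * D G ^ l ∈ Ideal.span {G} := by
  obtain ⟨W, hW⟩ := dvd_iterate_apply_pow_sub' D G l 0
  rw [Ideal.mem_span_singleton]
  simp only [zero_add, pow_zero, one_mul, pow_one, Nat.descFactorial_self] at hW
  exact ⟨W, hW⟩

/-- **The step of p. 159** ("`Tˡ(GˡH) ∈ 𝔮` … implies `(TG)ˡH ∈ 𝔮` … we have `TG ∈ 𝔮`"): `𝔮` prime
with `l! ∉ 𝔮`, `Dˡ(𝔞) ⊂ 𝔮`, `H ∉ 𝔮`, and `GˡH ∈ 𝔞` for every `G` in a subset `S ⊆ 𝔮`; then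
`DG ∈ 𝔮` for every `G ∈ S`. [cite: NesterenkoPhilippon2001, Ch. 10 proof of Prop. 3.6 (p. 159)] -/
theorem apply_mem_of_forall_pow_mul_mem' {𝔮 𝔞 : Ideal A} (h𝔮 : 𝔮.IsPrime) {l : ℕ}
    (hfac : ((l.factorial : ℕ) : A) ∉ 𝔮) (h𝔞 : ∀ a ∈ 𝔞, D^[l] a ∈ 𝔮) {H : A} (hH : H ∉ 𝔮)
    {G : A} (hG : G ∈ 𝔮) (hGH : G ^ l * H ∈ 𝔞) : D G ∈ 𝔮 := by
  have hspan : Ideal.span {G} ≤ 𝔮 := (Ideal.span_singleton_le_iff_mem _).mpr hG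
  have h1 : D^[l] (G ^ l * H) ∈ 𝔮 := h𝔞 _ hGH
  rw [iterate_apply_mul_eq_sum, Finset.Nat.sum_antidiagonal_eq_sum_range_succ
    (fun i j => l.choose i • (D^[i] (G ^ l) * D^[j] H)), Finset.sum_range_succ,
    Nat.choose_self, one_smul, Nat.sub_self, Function.iterate_zero, id_eq] at h1
  have h2 : ∑ i ∈ range l, l.choose i • (D^[i] (G ^ l) * D^[l - i] H) ∈ 𝔮 := by
    refine 𝔮.sum_mem fun i hi => ?_
    rw [mem_range] at hi
    exact Submodule.smul_of_tower_mem _ _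
      (𝔮.mul_mem_right _ (hspan (iterate_apply_pow_mem_span_of_lt' D G hi)))
  have h3 : D^[l] (G ^ l) * H ∈ 𝔮 := by
    have := 𝔮.sub_mem h1 h2; rwa [add_sub_cancel_left] at this
  have h4 : ((l.factorial : ℕ) : A) * D G ^ l * H ∈ 𝔮 := by
    have h5 : (D^[l] (G ^ l) - ((l.factorial : ℕ) : A) * D G ^ l) * H ∈ 𝔮 :=
      𝔮.mul_mem_right _ (hspan (iterate_apply_pow_self_sub_mem_span' D G l))
    have := 𝔮.sub_mem h3 h5; rwa [sub_mul, sub_sub_cancel] at this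
  rcases h𝔮.mem_or_mem h4 with h6 | h6
  · rcases h𝔮.mem_or_mem h6 with h7 | h7
    · exact absurd h7 hfac
    · exact h𝔮.mem_of_pow_mem l h7
  · exact absurd h6 hH

/-- Over a `ℚ`-algebra, `l! ∉ 𝔮` for every proper ideal. [folklore] -/
theorem natCast_factorial_notMem' {B : Type*} [CommRing B] [Algebra ℚ B] {𝔮 : Ideal B}
    (h𝔮 : 𝔮 ≠ ⊤) (l : ℕ) : ((l.factorial : ℕ) : B) ∉ 𝔮 := by
  intro h
  apply h𝔮
  refine Ideal.eq_top_of_isUnit_mem _ h ?_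
  have : ((l.factorial : ℕ) : B) = algebraMap ℚ B (l.factorial : ℚ) := by simp
  rw [this]
  exact (IsUnit.mk0 _ (by exact_mod_cast l.factorial_ne_zero)).map _

/-- **Peeling a factor outside a prime**: if `Dʲ(c a) ∈ 𝔮` for all `j ≤ l` and `c ∉ 𝔮` (`𝔮` prime),
then `Dʲ a ∈ 𝔮` for all `j ≤ l` (induction on `j`, Leibniz). [folklore] -/
theorem iterate_apply_mem_of_mul {𝔮 : Ideal A} (h𝔮 : 𝔮.IsPrime) {c a : A} (hc : c ∉ 𝔮) {l : ℕ}
    (h : ∀ j ≤ l, D^[j] (c * a) ∈ 𝔮) : ∀ j ≤ l, D^[j] a ∈ 𝔮 := by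
  intro j
  induction j using Nat.strong_induction_on with
  | _ j ih =>
    intro hj
    have h1 := h j hj
    rw [iterate_apply_mul_eq_sum, Finset.Nat.sum_antidiagonal_eq_sum_range_succ_mk, Finset.sum_range_succ',
      Nat.choose_zero_right, one_smul, Function.iterate_zero, id_eq, Nat.sub_zero] at h1
    -- the terms with a positive number of derivatives on `c` are in `𝔮` by induction
    have h2 : ∑ i ∈ range j, j.choose (i + 1) • (D^[i + 1] c * D^[j - (i + 1)] a) ∈ 𝔮 := by
      refine 𝔮.sum_mem fun i hi => ?_
      rw [mem_range] at hi
      exact Submodule.smul_of_tower_mem _ _ (𝔮.mul_mem_left _ (ih (j - (i + 1)) (by omega) (by omega)))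
    have h3 : c * D^[j] a ∈ 𝔮 := by
      have := 𝔮.sub_mem h1 h2; rwa [add_sub_cancel_left] at this
    exact (h𝔮.mem_or_mem h3).resolve_left hc

end Derivations

/-! ### Spans of iterates, degrees under `D`, and the passage to `ℂ[z, x̲]` -/

section Affine

variable {m : ℕ}

/-- **Iterating inside the span of iterates**: if `a ∈ (DᵏE : k < c)` then `Dʲa ∈ (DᵏE : k < c + j)`
("Condition 2 follows from definition of `E_{n+1}` and (63)", p. 159).
[cite: NesterenkoPhilippon2001, Ch. 10 proof of Prop. 3.6 (p. 159)] -/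
theorem iterate_mem_span_iterate (D : Derivation ℂ (Rzx m) (Rzx m)) (E : Rzx m) {c j : ℕ} {a : Rzx m}
    (ha : a ∈ Ideal.span ((fun k => D^[k] E) '' Set.Iio c)) :
    D^[j] a ∈ Ideal.span ((fun k => D^[k] E) '' Set.Iio (c + j)) := by
  refine iterate_apply_mem_of_span_of_forall D (l := j) ?_ a ha j le_rfl
  rintro g ⟨k, hk, rfl⟩ k' hk'
  rw [Set.mem_Iio] at hk
  refine Ideal.subset_span ⟨k' + k, ?_, ?_⟩
  · rw [Set.mem_Iio]; omega
  · exact (Function.iterate_add_apply D k' k E)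

/-- Monotonicity of the spans of iterates in `c`. [folklore] -/
theorem span_iterate_mono (D : Derivation ℂ (Rzx m) (Rzx m)) (E : Rzx m) {c c' : ℕ} (h : c ≤ c') :
    Ideal.span ((fun k => D^[k] E) '' Set.Iio c) ≤ Ideal.span ((fun k => D^[k] E) '' Set.Iio c') :=
  Ideal.span_mono (Set.image_mono (Set.Iio_subset_Iio h))

/-- `DᵏE` lies in the span of the iterates `DⁱE`, `i < c`, for `k < c`. [folklore] -/
theorem iterate_mem_span_iterate_self (D : Derivation ℂ (Rzx m) (Rzx m)) (E : Rzx m) {k c : ℕ}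
    (hk : k < c) : D^[k] E ∈ Ideal.span ((fun k => D^[k] E) '' Set.Iio c) :=
  Ideal.subset_span ⟨k, hk, rfl⟩

/-- `xdeg` is monotone. [folklore] -/
theorem xdeg_mono {e e' : Fin (m + 1) →₀ ℕ} (h : e ≤ e') : xdeg e ≤ xdeg e' :=
  Finset.sum_le_sum fun j _ => h j.succ

/-- **`deg_x̲ (∂E/∂x_i) ≤ deg_x̲ E`** (and the same for `∂/∂z`). [folklore] -/
theorem xDegree_pderiv_le (i : Fin (m + 1)) (E : Rzx m) : xDegree (pderiv i E) ≤ xDegree E := by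
  conv_lhs => rw [E.as_sum]
  rw [map_sum]
  refine xDegree_sum_le _ _ fun e he => ?_
  rw [pderiv_monomial]
  exact (xDegree_monomial_le _ _).trans ((xdeg_mono tsub_le_self).trans (xdeg_le_xDegree he))

/-- `deg_z (∂E/∂x_i) ≤ deg_z E` (and the same for `∂/∂z`). [folklore] -/
theorem degreeOf_zero_pderiv_le (i : Fin (m + 1)) (E : Rzx m) :
    (pderiv i E).degreeOf 0 ≤ E.degreeOf 0 := by
  classical
  conv_lhs => rw [E.as_sum]
  rw [map_sum]
  refine (degreeOf_sum_le _ _ _).trans (Finset.sup_le fun e he => ?_)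
  rw [pderiv_monomial]
  refine (degreeOf_le_iff.mpr fun e' he' => ?_)
  · rw [Finset.mem_singleton.mp (support_monomial_subset he')]
    exact (tsub_le_self (b := (Finsupp.single i 1) 0)).trans (monomial_le_degreeOf 0 he)

/-- **`deg_x̲ (DE) ≤ deg_x̲ E + d`** for `d ≥ max_j deg_x̲ A_j`.
[cite: NesterenkoPhilippon2001, Ch. 10 proof of Prop. 3.6 (p. 159: "`deg E_{n+1} ≤ b_n(L+1) + 2d₀λa_n`")] -/
theorem xDegree_dOp_le (A : Fin (m + 1) → Rzx m) {d : ℕ} (hd : ∀ i, xDegree (A i) ≤ d) (E : Rzx m) :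
    xDegree (dOp A E) ≤ xDegree E + d := by
  unfold dOp
  refine xDegree_sum_le _ _ fun i _ => (xDegree_mul_le _ _).trans ?_
  have := hd i
  have := xDegree_pderiv_le i E
  omega

/-- `deg_z (DE) ≤ deg_z E + d_z` for `d_z ≥ max_j deg_z A_j`. [cite: NesterenkoPhilippon2001, Ch. 10 proof of Prop. 3.6 (p. 159)] -/
theorem degreeOf_zero_dOp_le (A : Fin (m + 1) → Rzx m) {dz : ℕ} (hdz : ∀ i, (A i).degreeOf 0 ≤ dz)
    (E : Rzx m) : (dOp A E).degreeOf 0 ≤ E.degreeOf 0 + dz := by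
  classical
  unfold dOp
  refine (degreeOf_sum_le _ _ _).trans (Finset.sup_le fun i _ => (degreeOf_mul_le _ _ _).trans ?_)
  have := hdz i
  have := degreeOf_zero_pderiv_le i E
  omega

/-- Iterated: `deg_x̲ (DᵏE) ≤ deg_x̲ E + k d`. [cite: NesterenkoPhilippon2001, Ch. 10 proof of Prop. 3.6 (p. 159)] -/
theorem xDegree_dOp_iterate_le (A : Fin (m + 1) → Rzx m) {d : ℕ} (hd : ∀ i, xDegree (A i) ≤ d)
    (E : Rzx m) (k : ℕ) : xDegree ((dOp A)^[k] E) ≤ xDegree E + k * d := by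
  induction k with
  | zero => simp
  | succ k ih =>
    rw [Function.iterate_succ_apply']
    exact (xDegree_dOp_le A hd _).trans (by rw [Nat.succ_mul]; omega)

/-- Iterated: `deg_z (DᵏE) ≤ deg_z E + k d_z`. [cite: NesterenkoPhilippon2001, Ch. 10 proof of Prop. 3.6 (p. 159)] -/
theorem degreeOf_zero_dOp_iterate_le (A : Fin (m + 1) → Rzx m) {dz : ℕ}
    (hdz : ∀ i, (A i).degreeOf 0 ≤ dz) (E : Rzx m) (k : ℕ) :
    ((dOp A)^[k] E).degreeOf 0 ≤ E.degreeOf 0 + k * dz := by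
  induction k with
  | zero => simp
  | succ k ih =>
    rw [Function.iterate_succ_apply']
    exact (degreeOf_zero_dOp_le A hdz _).trans (by rw [Nat.succ_mul]; omega)

/-- `c(z) ∉ 𝔞(𝔮)` for a non-zero polynomial `c` when `𝔮` is prime with `x₀ ∉ 𝔮` (`c` is a unit of
`K = ℂ(z)`). [cite: NesterenkoPhilippon2001, Ch. 10 Lemma 3.4 (p. 155)] -/
theorem aeval_X_zero_notMem_affContr {𝔮 : Ideal (Kx m)} [h𝔮 : 𝔮.IsPrime] (hx : (X 0 : Kx m) ∉ 𝔮)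
    {c : ℂ[X]} (hc : c ≠ 0) : Polynomial.aeval (X 0 : Rzx m) c ∉ affContr 𝔮 := by
  rintro ⟨n, -, hmem⟩
  have e : homogTo n (Polynomial.aeval (X 0 : Rzx m) c) = X 0 ^ n * C c := by
    have h0 : homogTo 0 (dehomog (C c : Czx m)) = C c :=
      homogTo_dehomog (isHomogeneous_C (Fin (m + 1)) c)
    rw [dehomog_C] at h0
    have hx0 : xDegree (Polynomial.aeval (X 0 : Rzx m) c) ≤ 0 :=
      xDegree_le_of_homogTo_dehomog (m := m) (isHomogeneous_C (Fin (m + 1)) c) (dehomog_C (m := m) c)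
    have h1 := homogTo_add_eq_X_pow_mul hx0 n
    rw [zero_add] at h1
    rw [h1, h0]
  rw [e, map_mul, map_pow, toK_X, toK_C] at hmem
  rcases h𝔮.mem_or_mem hmem with h | h
  · exact hx (h𝔮.mem_of_pow_mem n h)
  · have hu : IsUnit (C (algebraMap ℂ[X] (RatFunc ℂ) c) : Kx m) :=
      (isUnit_iff_ne_zero.mpr
        ((map_ne_zero_iff _ (IsFractionRing.injective ℂ[X] (RatFunc ℂ))).mpr hc)).map C
    exact h𝔮.ne_top (Ideal.eq_top_of_isUnit_mem _ h hu)

/-- Elements of the span of a family whose homogenisations lie in an ideal `𝔞 ⊆ K[x̲]` have their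
homogenisations in `𝔞`: `a ∈ (E₀, …, E_k) ℂ[z, x̲] ⇒ a ∈ 𝔞(𝔞')` whenever all `E_i ∈ 𝔞(𝔞')`. [folklore] -/
theorem span_le_affContr {ι : Type*} {E : ι → Rzx m} {𝔞 : Ideal (Kx m)}
    (h : ∀ i, E i ∈ affContr 𝔞) : Ideal.span (Set.range E) ≤ affContr 𝔞 :=
  Ideal.span_le.mpr (Set.range_subset_iff.mpr h)

/-- The generators of `𝔞_n = (Ê₀, …, Ê_k) K[x̲]` (`Ê = x₀^{deg E} E(x/x₀)`) lie in its affine trace. [folklore] -/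
theorem mem_affContr_span_homog {ι : Type*} (E : ι → Rzx m) (i : ι) :
    E i ∈ affContr (Ideal.span (Set.range fun i => toK (homog (E i)))) :=
  mem_affContr_of_homog_mem (Ideal.subset_span ⟨i, rfl⟩)

/-- **From `K[x̲]` back to `ℂ[z, x̲]`**: if `x₀ⁿ a(x/x₀) ∈ (Ê₀, …, Ê_k) K[x̲]`, `Êᵢ = x₀^{deg Eᵢ} Eᵢ(x/x₀)`,
then `c(z) · a ∈ (E₀, …, E_k) ℂ[z, x̲]` for some polynomial `c ≠ 0` (clear the denominators of the
coefficients and put `x₀ = 1`). [cite: NesterenkoPhilippon2001, Ch. 10 proof of Prop. 3.6 (p. 159)] -/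
theorem exists_aeval_mul_mem_span_of_mem_affContr {k : ℕ} (E : Fin k → Rzx m) {a : Rzx m}
    (ha : a ∈ affContr (Ideal.span (Set.range fun i => toK (homog (E i))))) :
    ∃ c : ℂ[X], c ≠ 0 ∧ Polynomial.aeval (X 0 : Rzx m) c * a ∈ Ideal.span (Set.range E) := by
  classical
  obtain ⟨n, -, hmem⟩ := ha
  obtain ⟨g, hg⟩ := Ideal.mem_span_range_iff_exists_fun.mp hmem
  -- clear denominators of the coefficients `g i`
  choose c hc G hG hsupp using fun i => exists_toK_eq_C_mul (g i)
  set ctot : ℂ[X] := ∏ i, c i with hctot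
  have hctot0 : ctot ≠ 0 := Finset.prod_ne_zero_iff.mpr fun i _ => hc i
  -- `ctot • x₀ⁿ a(x/x₀) = Σ (∏_{j ≠ i} c_j) G_i Ê_i`
  have key : toK (C ctot * homogTo n a) =
      toK (∑ i, C (∏ j ∈ Finset.univ.erase i, c j) * G i * homog (E i)) := by
    rw [map_mul, toK_C, ← hg, Finset.mul_sum, map_sum]
    refine Finset.sum_congr rfl fun i _ => ?_
    rw [map_mul, map_mul, toK_C, hG i, hctot, ← Finset.mul_prod_erase _ _ (Finset.mem_univ i), map_mul,
      map_mul]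
    ring
  have key' := toK_injective key
  refine ⟨ctot, hctot0, ?_⟩
  have hd := congrArg dehomog key'
  rw [map_mul, dehomog_C, dehomog_homogTo, map_sum] at hd
  rw [hd]
  refine Ideal.sum_mem _ fun i _ => ?_
  rw [map_mul, dehomog_homog]
  exact Ideal.mul_mem_left _ _ (Ideal.subset_span ⟨i, rfl⟩)

end Affine

/-! ### Homogeneous multipliers (`K[x̲]` side) -/

section Graded

variable {m : ℕ}

attribute [local instance] MvPolynomial.gradedAlgebra

/-- The homogeneous components of a member of a homogeneous ideal of `K[x̲]` lie in it. [folklore] -/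
theorem homogeneousComponent_mem_of_mem {𝔞 : Ideal (Kx m)}
    (h𝔞 : 𝔞.IsHomogeneous (homogeneousSubmodule (Fin (m + 1)) (RatFunc ℂ))) {P : Kx m} (hP : P ∈ 𝔞)
    (k : ℕ) : homogeneousComponent k P ∈ 𝔞 := by
  have e : (DirectSum.decompose (homogeneousSubmodule (Fin (m + 1)) (RatFunc ℂ)) P k : Kx m) =
      homogeneousComponent k P :=
    weightedDecomposition.decompose'_apply (RatFunc ℂ) (1 : Fin (m + 1) → ℕ) P k
  rw [← e]
  exact (h𝔞.mem_iff.mp hP) k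

/-- An element outside an ideal has a homogeneous component outside it. [folklore] -/
theorem exists_homogeneousComponent_notMem {𝔮 : Ideal (Kx m)} {P : Kx m} (hP : P ∉ 𝔮) :
    ∃ k : ℕ, homogeneousComponent k P ∉ 𝔮 := by
  by_contra h
  push Not at h
  apply hP
  rw [← sum_homogeneousComponent P]
  exact 𝔮.sum_mem fun k _ => h k

/-- **A homogeneous multiplier**: if `H₀ ∉ 𝔮` and `GˡH₀ ∈ 𝔞` for all `G ∈ 𝔮` (`𝔞` homogeneous),
then some homogeneous component `H` of `H₀` has `H ∉ 𝔮` and `GˡH ∈ 𝔞` for every FORM `G ∈ 𝔮`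
(take components: `(GˡH₀)_{dl+k} = Gˡ (H₀)_k`; `𝔞` homogeneous). Used on p. 159 for the `H ∉ 𝔮` with `GˡH ∈ 𝔞_n`.
[cite: NesterenkoPhilippon2001, Ch. 10 proof of Prop. 3.6 (p. 159)] -/
theorem exists_isHomogeneous_notMem_forall_pow_mul_mem {𝔞 𝔮 : Ideal (Kx m)}
    (h𝔞 : 𝔞.IsHomogeneous (homogeneousSubmodule (Fin (m + 1)) (RatFunc ℂ))) {l : ℕ} {H₀ : Kx m}
    (hH₀ : H₀ ∉ 𝔮) (hmem : ∀ G ∈ 𝔮, G ^ l * H₀ ∈ 𝔞) :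
    ∃ (H : Kx m) (k : ℕ), H.IsHomogeneous k ∧ H ∉ 𝔮 ∧
      ∀ (G : Kx m) (d : ℕ), G.IsHomogeneous d → G ∈ 𝔮 → G ^ l * H ∈ 𝔞 := by
  obtain ⟨k, hk⟩ := exists_homogeneousComponent_notMem hH₀
  refine ⟨homogeneousComponent k H₀, k, homogeneousComponent_isHomogeneous k H₀, hk,
    fun G d hG hGmem => ?_⟩
  have hGl : (G ^ l).IsHomogeneous (d * l) := hG.pow l
  have h1 := homogeneousComponent_mem_of_mem h𝔞 (hmem G hGmem) (k + d * l)
  rwa [Literature.RingTheory.MvPolynomial.homogeneousComponent_mul_add_of_isHomogeneous hGl] at h1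

/-- `deg_x̲ (Aˡ) ≤ l · deg_x̲ A`. [folklore] -/
theorem xDegree_pow_le (A : Rzx m) (l : ℕ) : xDegree (A ^ l) ≤ l * xDegree A := by
  induction l with
  | zero =>
    rw [pow_zero, zero_mul, ← C_1]
    exact (xDegree_monomial_le 0 (1 : ℂ)).trans (by simp [xdeg])
  | succ l ih =>
    rw [pow_succ, Nat.succ_mul]
    exact (xDegree_mul_le _ _).trans (by omega)

/-- **Homogenisation of powers**: `x₀^{ln} Aˡ(x/x₀) = (x₀ⁿ A(x/x₀))ˡ`. [folklore] -/
theorem homogTo_pow {n : ℕ} {A : Rzx m} (hA : xDegree A ≤ n) (l : ℕ) :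
    homogTo (l * n) (A ^ l) = homogTo n A ^ l := by
  induction l with
  | zero => rw [zero_mul, pow_zero, pow_zero, homogTo_one, pow_zero]
  | succ l ih =>
    rw [Nat.succ_mul, pow_succ, pow_succ, homogTo_mul ((xDegree_pow_le A l).trans (by gcongr)) hA, ih]

/-- **Back to the affine trace**: if `H₁ ∈ ℂ[z][x̲]` is a form with `Ĝˡ H₁ ∈ 𝔞` for every form `Ĝ ∈ 𝔮`,
then `Gˡ · H₁(z, 1, x̲) ∈ 𝔞(𝔞)` for every `G` in the affine trace `𝔞(𝔮)` (homogenise: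
`x₀^{ln+k}(GˡH₁|_{x₀=1})(x/x₀) = (x₀ⁿG(x/x₀))ˡ H₁`). [cite: NesterenkoPhilippon2001, Ch. 10 proof of Prop. 3.6 (p. 159)] -/
theorem pow_mul_dehomog_mem_affContr {𝔮 𝔞 : Ideal (Kx m)} {l k : ℕ} {H₁ : Czx m}
    (hH₁ : H₁.IsHomogeneous k)
    (hH : ∀ (G : Kx m) (d : ℕ), G.IsHomogeneous d → G ∈ 𝔮 → G ^ l * toK H₁ ∈ 𝔞)
    {G : Rzx m} (hG : G ∈ affContr 𝔮) : G ^ l * dehomog H₁ ∈ affContr 𝔞 := by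
  obtain ⟨n, hn, hGn⟩ := hG
  refine ⟨l * n + k, (xDegree_mul_le _ _).trans
    (Nat.add_le_add ((xDegree_pow_le G l).trans (by gcongr)) (xDegree_dehomog_le hH₁)), ?_⟩
  rw [homogTo_mul ((xDegree_pow_le G l).trans (by gcongr)) (xDegree_dehomog_le hH₁), homogTo_pow hn,
    homogTo_dehomog hH₁, map_mul, map_pow]
  exact hH _ n (isHomogeneous_toK (isHomogeneous_homogTo hn)) hGn

end Graded

end NesterenkoMultiplicity

end Literature.NumberTheory.Transcendental

end
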